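/-
Copyright (c) 2026. All rights reserved.
Released under Apache 2.0 license as described in the file LICENSE.
-/
import Literature.NumberTheory.Automorphic.DefiniteMaximalOrdersLeftOrderFibres
import Literature.NumberTheory.Automorphic.EichlerOrderAtkinLehnerIdeal
import Literature.NumberTheory.Automorphic.BrandtTypeSet
import Literature.NumberTheory.Automorphic.EichlerSubidealCount
import HarnessLib

/-!
# The Atkin–Lehner involutions `W_{q⁻}` (`q ∣ N⁻`) and `W_{p⁺}` (`p^e ∥ N⁺`) of the class set of a Brandt setup: commuting
# involutions of `Cls O` preserving types and weights, with `T(q)` the permutation matrix of `W_{q⁻}`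
# (Vignéras III §5 exercice 5.8 (b)–(d); Voight 41.3.4, 23.4; Bertolini–Darmon 1996 §1.5)

[tag: quaternion_algebra] [tag: eichler_order] [tag: class_number] [tag: hecke_operator]

Topic `NumberTheory/Automorphic`. Two definitions with bodies (`Brandt.XiSetup.wMinus`, `Brandt.XiSetup.wPlus`) and theorems;
no named fact, no instance. Lane `lit-hodgefound`, seat p12, gen 51 — the «TODO(general form)» of
`DefiniteMaximalOrdersLeftOrderFibres.lean` §5 (gen 50: the involution `[I] ↦ [I 𝔓]` for setups of type `(1, p)` only).

For a Brandt setup `S` of type `(N⁺, N⁻)` (`BrandtXi.lean`: a definite quaternion algebra `D` of discriminant `N⁻` with an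
Eichler order `O` of level `N⁺`) the tree has the two-sided ideals behind the Atkin–Lehner operators: the prime
`𝔓_q = normPrimeIdeal O q` above a ramified prime `q ∣ N⁻` (`RamifiedPrimeIdeal.lean`, `BrandtMatrixRamified.lean`: `I 𝔓_q` is
an invertible right ideal, `I 𝔓_q 𝔓_q = q I`) and the Atkin–Lehner ideal `𝔔_{p^e} = atkinLehnerIdeal O (p^e)` at a split
prime `p`, `e = v_p(N⁺)` (`EichlerOrderAtkinLehnerIdeal.lean`: `I 𝔔 𝔔 = p^e I`, `𝔔_m 𝔔_{m'} = 𝔔_{m'} 𝔔_m`,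
`𝔔_m 𝔓_q = 𝔓_q 𝔔_m`). Bertolini–Darmon, Invent. Math. 126 (1996) §1.5: «the involutions `W_{l⁺}`, `W_{l⁻}` … acting on
`Pic`»; Vignéras III §5 ex. 5.8: the permutation matrices `L(A)` of `I_i ↦ I_i A` and (d) «les matrices de Brandt et les
matrices de permutation engendrent une `R`-algèbre commutative»; Voight 41.3.4 (`P(𝔞)`, `I_i ↦ 𝔞 I_i`). This file builds
the induced maps on the class set `Cls O = Brandt.ClassSet S.O`:

* §1 the local hypotheses of a setup at a ramified prime (`XiSetup.hdiv_of_dvd`, `XiSetup.maximalAt_of_dvd`), the right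
  ideals `I 𝔓_q`, `I 𝔔_{p^e}` (`XiSetup.mul_normPrimeIdeal_mem_of_dvd`, `XiSetup.mul_atkinLehnerIdeal_mem`),
  `𝔓_q 𝔓_{q'} = 𝔓_{q'} 𝔓_q` (`normPrimeIdeal_mul_normPrimeIdeal_comm`);
* §2 generic right multiplication by a lattice `T` on classes: well defined (`XiSetup.mk_mul_congr`), an involution when
  `I T T = m I` (`XiSetup.mk_rep_mul_mk_rep_mul_eq_self`), type-preserving (`XiSetup.leftOrder_mul_eq_of_mul_mul`);
* §3 **`XiSetup.wMinus S q hq : Cls O → Cls O`, `[I] ↦ [I 𝔓_q]`** and **`XiSetup.wPlus S p hp`, `[I] ↦ [I 𝔔_{p^{v_p(N⁺)}}]`**: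
  computed on any representative (`wMinus_mk`, `wPlus_mk`), **involutions** (`wMinus_wMinus`, `wPlus_wPlus`), **pairwise
  commuting** (`wMinus_comm`, `wPlus_comm`, `wPlus_wMinus_comm`), `wPlus = id` at `p ∤ N⁺` (`wPlus_eq_self_of_not_dvd`), and
  for type `(1, p)` `wMinus` is the involution of gen 50 (`wMinus_eq`);
* §4 **types and weights are invariant**: `O_L(I 𝔓_q) = O_L(I)`, `O_L(I 𝔔) = O_L(I)`, `typeOf (W c) = typeOf c`,
  `w_{W c} = w_c` for both kinds;
* §5 **`T(q)` is the permutation matrix of `W_{q⁻}`** for every setup and every `q ∣ N⁻` (`XiSetup.matrix_ramified_apply_of_dvd`: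
  `T(q)_{c c'} = [c = W_{q⁻} c']`, Vignéras ex. 5.8 (b) `c(q) = 1`), `T(q)` symmetric.

## References

* [VignerasLNM800] M.-F. Vignéras, *Arithmétique des algèbres de quaternions*, LNM 800 (1980), Ch. II §1 Cor. 1.7, §2 (ordres
  d'Eichler, normalisateur), Ch. III §5 exercice 5.8 (b)–(d) (p. 87 of the held copy).
* [Voight2021] J. Voight, *Quaternion Algebras*, GTM 288: 18.4.8, Prop. 18.5.10, 23.4.14 ff. (Atkin–Lehner group of an
  Eichler order), 41.3.4–(41.3.5).
* [BertoliniDarmon1996] M. Bertolini, H. Darmon, *Heegner points on Mumford–Tate curves*, Invent. Math. 126 (1996), §1.5.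

## Scope (honest)

Two definitions and theorems. Not here: the compatibility of `W_{p⁺}` with the Brandt matrices `T(n)` (the bijection
`J ↦ J 𝔔`), the structure of the group generated by the `W`'s on `Cls O` (it may act with fixed points or trivially),
and the fibres of the type map at general level.
-/

noncomputable section

open scoped Pointwise

universe u

namespace Literature.NumberTheory.Automorphic

/-! ## §1 Two-sided ideals of a Brandt setup at the primes of the level and of the discriminant -/

section TwoSided

variable {B : Type u} [Ring B] [Algebra ℚ B] [IsQuaternionAlgebra ℚ B] {O : Submodule ℤ B}

/-- `𝔓_q O = 𝔓_q`: the prime above `q` is a right `O`-module. [cite: VignerasLNM800, Ch. II §1 Cor. 1.7] -/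
theorem normPrimeIdeal_mul_order (hO : IsZOrder O) (q : ℕ) : normPrimeIdeal O q * O = normPrimeIdeal O q := by
  refine le_antisymm (Submodule.mul_le.mpr fun x hx a ha => mul_mem_normPrimeIdeal_right hO ha hx) fun x hx => ?_
  rw [← mul_one x]
  exact Submodule.mul_mem_mul hx hO.one_mem

/-- Away from `q` the prime `𝔓_q` is locally trivial: `(𝔓_q)₍r₎ = O₍r₎` for primes `r ≠ q` (`q O ⊆ 𝔓_q ⊆ O`). [cite: VignerasLNM800, Ch. III §5 Prop. 5.1] -/
theorem localAt_normPrimeIdeal_eq_of_ne (hO : IsZOrder O) {q r : ℕ} (hq : q.Prime) (hr : r.Prime) (hrq : r ≠ q) :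
    localAt r (normPrimeIdeal O q) = localAt r O :=
  (localAt_eq_of_smul_le (normPrimeIdeal_le O q) hq.ne_zero ((Nat.coprime_primes hq hr).mpr (Ne.symm hrq))
    fun x hx => smul_le_normPrimeIdeal hO (Submodule.smul_mem_pointwise_smul x _ O hx)).symm

/-- **`𝔓_q 𝔓_{q'} = 𝔓_{q'} 𝔓_q`** for distinct primes `q, q'`: two-sided ideals of `O` that are locally trivial at
complementary primes commute (`mul_comm_of_forall_localAt`). [cite: VignerasLNM800, Ch. III §5 exercice 5.8 (c)–(d)] -/
theorem normPrimeIdeal_mul_normPrimeIdeal_comm (hO : IsZOrder O) {q q' : ℕ} (hq : q.Prime) (hq' : q'.Prime) (hqq' : q ≠ q') :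
    normPrimeIdeal O q * normPrimeIdeal O q' = normPrimeIdeal O q' * normPrimeIdeal O q :=
  mul_comm_of_forall_localAt (order_mul_normPrimeIdeal hO) (normPrimeIdeal_mul_order hO q)
    (order_mul_normPrimeIdeal hO) (normPrimeIdeal_mul_order hO q') fun r hr => by
    by_cases hrq : r = q
    · right
      subst hrq
      exact localAt_normPrimeIdeal_eq_of_ne hO hq' hr hqq'
    · left
      exact localAt_normPrimeIdeal_eq_of_ne hO hq hr hrq

end TwoSided

namespace Brandt

variable {Nplus Nminus : ℕ} (S : XiSetup Nplus Nminus)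

/-- The algebra of a setup is a division algebra. [folklore] -/
private theorem XiSetup.hdivD' : ∀ x : S.D, x ≠ 0 → IsUnit x :=
  fun _ hx => isUnit_of_isTotallyDefinite S.D S.isTotallyDefinite hx

/-- At a prime `q ∣ N⁻` the completion `ℚ_q ⊗ D` is a division algebra. [cite: VignerasLNM800, Ch. II §1 Thm. 1.1 and Ch. III §3] -/
theorem XiSetup.hdiv_of_dvd {q : ℕ} [Fact q.Prime] (hq : q ∣ Nminus) :
    ∀ X : ScalarExtension ℚ ℚ_[q] S.D, X ≠ 0 → IsUnit X :=
  S.toEichlerPackage.forall_isUnit_scalarExtension_padic hq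

/-- At a prime `q ∣ N⁻` the Eichler order is maximal: `O₍q₎ = {x : nrd x, trd x ∈ ℤ₍q₎}`. [cite: VignerasLNM800, Ch. III §5 (ordres d'Eichler, propriétés locales)] -/
theorem XiSetup.maximalAt_of_dvd {q : ℕ} [Fact q.Prime] (hq : q ∣ Nminus) :
    ∀ x : S.D, x ∈ localAt q S.O ↔ ¬ q ∣ (reducedNorm ℚ S.D x).den ∧ ¬ q ∣ (reducedTrace ℚ S.D x).den :=
  S.toEichlerPackage.maximalAtP hq

/-- **`I 𝔓_q` is a right `O`-ideal** for every right `O`-ideal `I` and every `q ∣ N⁻`. [cite: VignerasLNM800, Ch. II §1 Cor. 1.7] -/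
theorem XiSetup.mul_normPrimeIdeal_mem_of_dvd {q : ℕ} [Fact q.Prime] (hq : q ∣ Nminus) {I : Submodule ℤ S.D}
    (hI : I ∈ rightIdeals S.O) : I * normPrimeIdeal S.O q ∈ rightIdeals S.O :=
  S.mem_rightIdeals_of_isInvertibleRightIdeal
    (isInvertibleRightIdeal_mul_normPrimeIdeal (S.hdiv_of_dvd hq) (S.maximalAt_of_dvd hq) S.isZOrder_O
      (S.isInvertibleRightIdeal_of_mem hI))

/-- **`I 𝔓_q 𝔓_q = q I`** for right `O`-ideals `I`, `q ∣ N⁻`. [cite: VignerasLNM800, Ch. II §1 Cor. 1.7 and Ch. III §5 exercice 5.8 (c)] -/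
theorem XiSetup.mul_normPrimeIdeal_mul_normPrimeIdeal_of_dvd {q : ℕ} [Fact q.Prime] (hq : q ∣ Nminus)
    {I : Submodule ℤ S.D} (hI : I ∈ rightIdeals S.O) :
    I * normPrimeIdeal S.O q * normPrimeIdeal S.O q = (q : ℤ) • I :=
  mul_normPrimeIdeal_mul_normPrimeIdeal (S.hdiv_of_dvd hq) (S.maximalAt_of_dvd hq) S.isZOrder_O
    (S.isInvertibleRightIdeal_of_mem hI)

/-- **`I 𝔔_{p^{v_p(N⁺)}}` is a right `O`-ideal** for every right `O`-ideal `I` and every prime `p ∤ N⁻` (a level model at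
`p` exists, `XiSetup.exists_isLevelShape_iff`). [cite: VignerasLNM800, Ch. II §2 and Ch. III §5] [cite: BertoliniDarmon1996, §1.5] -/
theorem XiSetup.mul_atkinLehnerIdeal_mem {p : ℕ} [Fact p.Prime] (hp : ¬ p ∣ Nminus) {I : Submodule ℤ S.D}
    (hI : I ∈ rightIdeals S.O) : I * atkinLehnerIdeal S.O (p ^ Nplus.factorization p) ∈ rightIdeals S.O := by
  obtain ⟨Φ, hΦ⟩ := S.exists_isLevelShape_iff S.nplus_ne_zero hp
  exact S.mem_rightIdeals_of_isInvertibleRightIdeal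
    (isInvertibleRightIdeal_mul_atkinLehnerIdeal Φ S.isZOrder_O hΦ S.hdivD' (S.isInvertibleRightIdeal_of_mem hI))

/-- **`I 𝔔 𝔔 = p^{v_p(N⁺)} I`** for right `O`-ideals `I`, `p ∤ N⁻`, `𝔔 = 𝔔_{p^{v_p(N⁺)}}`. [cite: VignerasLNM800, Ch. II §2 (normalisateur) and Ch. III §5] [cite: BertoliniDarmon1996, §1.5] -/
theorem XiSetup.mul_atkinLehnerIdeal_mul_atkinLehnerIdeal {p : ℕ} [Fact p.Prime] (hp : ¬ p ∣ Nminus)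
    {I : Submodule ℤ S.D} (hI : I ∈ rightIdeals S.O) :
    I * atkinLehnerIdeal S.O (p ^ Nplus.factorization p) * atkinLehnerIdeal S.O (p ^ Nplus.factorization p) =
      ((p ^ Nplus.factorization p : ℕ) : ℤ) • I := by
  obtain ⟨Φ, hΦ⟩ := S.exists_isLevelShape_iff S.nplus_ne_zero hp
  exact Literature.NumberTheory.Automorphic.mul_atkinLehnerIdeal_mul_atkinLehnerIdeal Φ S.isZOrder_O hΦ S.hdivD'
    (S.isInvertibleRightIdeal_of_mem hI)

/-- A prime `p ∤ N⁻` differs from every prime `q ∣ N⁻`, so `q ∤ p^e`. [folklore] -/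
private theorem not_dvd_pow_of_dvd {p q : ℕ} (hpq : q.Prime) (hpp : p.Prime) (hp : ¬ p ∣ Nminus) (hq : q ∣ Nminus)
    (e : ℕ) : ¬ q ∣ p ^ e := fun h => by
  have := (Nat.prime_dvd_prime_iff_eq hpq hpp).mp (hpq.dvd_of_dvd_pow h)
  subst this
  exact hp hq

/-! ## §2 Right multiplication by a two-sided ideal on the class set -/

/-- **Right multiplication by a lattice `T` is well defined on classes**: `[I] = [J] ⟹ [I T] = [J T]` (`(α I) T = α (I T)`).
[cite: Voight2021, 41.3.4] [cite: VignerasLNM800, Ch. III §5 exercice 5.8] -/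
theorem XiSetup.mk_mul_congr {T : Submodule ℤ S.D} (hT : ∀ I ∈ rightIdeals S.O, I * T ∈ rightIdeals S.O)
    {I J : Submodule ℤ S.D} (hI : I ∈ rightIdeals S.O) (hJ : J ∈ rightIdeals S.O)
    (h : (Quotient.mk (rightClassSetoid S.O) ⟨I, hI⟩ : ClassSet S.O) = Quotient.mk (rightClassSetoid S.O) ⟨J, hJ⟩) :
    (Quotient.mk (rightClassSetoid S.O) ⟨I * T, hT I hI⟩ : ClassSet S.O) =
      Quotient.mk (rightClassSetoid S.O) ⟨J * T, hT J hJ⟩ := by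
  obtain ⟨α, hα⟩ := Quotient.exact h
  have hα' : J = α • I := hα
  exact Quotient.sound ⟨α, show J * T = α • (I * T) by rw [hα', smul_mul_assoc]⟩

/-- `[I_{[I]} T] = [I T]`: right multiplication may be computed on any representative. [cite: Voight2021, 41.3.4] -/
theorem XiSetup.mk_rep_mk_mul {T : Submodule ℤ S.D} (hT : ∀ I ∈ rightIdeals S.O, I * T ∈ rightIdeals S.O)
    (I : rightIdeals S.O) :
    (Quotient.mk (rightClassSetoid S.O) ⟨ClassSet.rep (Quotient.mk (rightClassSetoid S.O) I : ClassSet S.O) * T,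
        hT _ (ClassSet.rep_mem _)⟩ : ClassSet S.O) =
      Quotient.mk (rightClassSetoid S.O) ⟨(I : Submodule ℤ S.D) * T, hT _ I.2⟩ :=
  S.mk_mul_congr hT (ClassSet.rep_mem _) I.2 (by rw [ClassSet.mk_rep])

/-- A central unit `ν = m · 1` acts as the integer `m`: `ν J = m J`. [folklore] -/
private theorem units_smul_eq_natCast_smul' {D : Type u} [Ring D] {ν : Dˣ} {m : ℕ} (hν : (ν : D) = (m : ℤ))
    (J : Submodule ℤ D) : ν • J = (m : ℤ) • J := by
  ext x
  constructor
  · intro hx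
    obtain ⟨y, hy, rfl⟩ := exists_eq_zsmul_of_mem_units_smul hν hx
    exact Submodule.smul_mem_pointwise_smul y _ J hy
  · intro hx
    obtain ⟨y, hy, rfl⟩ := (Submodule.mem_smul_pointwise_iff_exists x _ J).mp hx
    exact units_smul_eq_zsmul_of_val_eq hν J hy

/-- **Right multiplication by `T` is an involution on classes when `I T T = m I`** (`m ≥ 1`): `[[I_c T] T] = [m I_c] = c`.
[cite: VignerasLNM800, Ch. III §5 exercice 5.8 (c)] [cite: Voight2021, 41.3.4 (`P(𝔞) P(𝔞⁻¹) = 1`)] -/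
theorem XiSetup.mk_rep_mul_mk_rep_mul_eq_self {T : Submodule ℤ S.D} (hT : ∀ I ∈ rightIdeals S.O, I * T ∈ rightIdeals S.O)
    {m : ℕ} (hm : m ≠ 0) (hTT : ∀ I ∈ rightIdeals S.O, I * T * T = (m : ℤ) • I) (c : ClassSet S.O) :
    (Quotient.mk (rightClassSetoid S.O)
        ⟨ClassSet.rep (Quotient.mk (rightClassSetoid S.O) ⟨c.rep * T, hT _ c.rep_mem⟩ : ClassSet S.O) * T,
          hT _ (ClassSet.rep_mem _)⟩ : ClassSet S.O) = c := by
  rw [S.mk_rep_mk_mul hT ⟨c.rep * T, hT _ c.rep_mem⟩]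
  obtain ⟨ν, hν, -⟩ := exists_units_val_eq_natCast (D := S.D) hm
  have h3 : c.rep * T * T = ν • c.rep := by rw [hTT c.rep c.rep_mem, units_smul_eq_natCast_smul' hν]
  have e : (Quotient.mk (rightClassSetoid S.O) ⟨c.rep * T * T, hT _ (hT _ c.rep_mem)⟩ : ClassSet S.O) =
      Quotient.mk (rightClassSetoid S.O) ⟨c.rep, c.rep_mem⟩ :=
    Quotient.sound ⟨ν⁻¹, show c.rep = ν⁻¹ • (c.rep * T * T) by rw [h3, inv_smul_smul]⟩
  exact e.trans (ClassSet.mk_rep c)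

/-- **Two commuting right multiplications commute on classes**: if `T T' = T' T` then `[[I_c T'] T] = [[I_c T] T']`. [cite: VignerasLNM800, Ch. III §5 exercice 5.8 (d)] -/
theorem XiSetup.mk_rep_mul_comm {T T' : Submodule ℤ S.D} (hT : ∀ I ∈ rightIdeals S.O, I * T ∈ rightIdeals S.O)
    (hT' : ∀ I ∈ rightIdeals S.O, I * T' ∈ rightIdeals S.O) (hc : T * T' = T' * T) (c : ClassSet S.O) :
    (Quotient.mk (rightClassSetoid S.O)
        ⟨ClassSet.rep (Quotient.mk (rightClassSetoid S.O) ⟨c.rep * T', hT' _ c.rep_mem⟩ : ClassSet S.O) * T,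
          hT _ (ClassSet.rep_mem _)⟩ : ClassSet S.O) =
      Quotient.mk (rightClassSetoid S.O)
        ⟨ClassSet.rep (Quotient.mk (rightClassSetoid S.O) ⟨c.rep * T, hT _ c.rep_mem⟩ : ClassSet S.O) * T',
          hT' _ (ClassSet.rep_mem _)⟩ := by
  rw [S.mk_rep_mk_mul hT ⟨c.rep * T', hT' _ c.rep_mem⟩, S.mk_rep_mk_mul hT' ⟨c.rep * T, hT _ c.rep_mem⟩]
  have e : c.rep * T' * T = c.rep * T * T' := by rw [mul_assoc, mul_assoc, hc]
  exact Quotient.sound ⟨1, show c.rep * T * T' = (1 : S.Dˣ) • (c.rep * T' * T) by rw [one_smul, e]⟩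

/-- **`O_L(I T) = O_L(I)` when `I T T = m I`** (`m ≥ 1`): `O_L(I) ⊆ O_L(I T) ⊆ O_L(I T T) = O_L(m I) = O_L(I)`.
[cite: Voight2021, 18.4.8 and Lemma 17.4.11] -/
theorem XiSetup.leftOrder_mul_eq_of_mul_mul {I T : Submodule ℤ S.D} {m : ℕ} (hm : m ≠ 0) (h : I * T * T = (m : ℤ) • I) :
    leftOrder (I * T) = leftOrder I := by
  obtain ⟨ν, hν, -⟩ := exists_units_val_eq_natCast (D := S.D) hm
  have hmI : (m : ℤ) • I = ν • I := (units_smul_eq_natCast_smul' hν I).symm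
  have h3 : leftOrder ((m : ℤ) • I) = leftOrder I := by
    rw [hmI, ← leftOrderOf_eq_leftOrder, leftOrderOf_units_smul, leftOrderOf_eq_leftOrder]
    ext x
    rw [mem_units_smul_submodule_iff, mem_op_units_smul_submodule_iff, inv_inv, Units.smul_def, smul_eq_mul]
    have hcx : x * (ν : S.D) = ν * x := by rw [hν]; exact ((Int.cast_commute (m : ℤ) x).eq).symm
    have : ((ν⁻¹ : S.Dˣ) : S.D) * x * ν = x := by rw [mul_assoc, hcx, Units.inv_mul_cancel_left]
    rw [this]
  refine le_antisymm ?_ (leftOrder_le_leftOrder_mul I _)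
  calc leftOrder (I * T) ≤ leftOrder (I * T * T) := leftOrder_le_leftOrder_mul _ _
    _ = leftOrder I := by rw [h, h3]

/-- The type is preserved: `typeOf [I_c T] = typeOf c` when `I T T = m I` for all right ideals `I`. [cite: Voight2021, Remark 17.4.15 and Prop. 18.5.10] -/
theorem XiSetup.typeOf_mk_rep_mul {T : Submodule ℤ S.D} (hT : ∀ I ∈ rightIdeals S.O, I * T ∈ rightIdeals S.O)
    {m : ℕ} (hm : m ≠ 0) (hTT : ∀ I ∈ rightIdeals S.O, I * T * T = (m : ℤ) • I) (c : ClassSet S.O) :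
    typeOf S.O (Quotient.mk (rightClassSetoid S.O) ⟨c.rep * T, hT _ c.rep_mem⟩) = typeOf S.O c := by
  obtain ⟨β, hβ⟩ := exists_rep_mk_eq_smul (O := S.O) ⟨c.rep * T, hT _ c.rep_mem⟩
  refine (typeOf_eq_typeOf_iff.mpr ⟨β, ?_⟩).symm
  rw [hβ]
  change leftOrderOf (β • (c.rep * T)) = _
  rw [leftOrderOf_units_smul]
  change β • (MulOpposite.op ((β⁻¹ : S.Dˣ) : S.D) • leftOrder (c.rep * T)) = _
  rw [S.leftOrder_mul_eq_of_mul_mul hm (hTT c.rep c.rep_mem)]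

/-- The weight is preserved: `w_{[I_c T]} = w_c` when `I T T = m I` for all right ideals `I`. [cite: Voight2021, 41.1.3 and 18.4.8] -/
theorem XiSetup.weight_mk_rep_mul {T : Submodule ℤ S.D} (hT : ∀ I ∈ rightIdeals S.O, I * T ∈ rightIdeals S.O)
    {m : ℕ} (hm : m ≠ 0) (hTT : ∀ I ∈ rightIdeals S.O, I * T * T = (m : ℤ) • I) (c : ClassSet S.O) :
    weight S.O (Quotient.mk (rightClassSetoid S.O) ⟨c.rep * T, hT _ c.rep_mem⟩) = weight S.O c :=
  weight_eq_weight_of_typeOf_eq (S.typeOf_mk_rep_mul hT hm hTT c)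

/-! ## §3 The involutions `W_{q⁻}` and `W_{p⁺}` of `Cls O` -/

/-- **The Atkin–Lehner involution `W_{q⁻}` at a ramified prime `q ∣ N⁻`**: `[I] ↦ [I 𝔓_q]` on `Cls O` (Bertolini–Darmon's
`W_{l⁻}`; Vignéras' permutation `f : I_i A ∼ I_{f(i)}` for `A = 𝔓_q`; for type `(1, p)` the involution of
`DefiniteMaximalOrdersLeftOrderFibres.lean`). [cite: BertoliniDarmon1996, §1.5] [cite: VignerasLNM800, Ch. III §5 exercice 5.8] -/
def XiSetup.wMinus (q : ℕ) [Fact q.Prime] (hq : q ∣ Nminus) : ClassSet S.O → ClassSet S.O := fun c =>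
  Quotient.mk (rightClassSetoid S.O) ⟨c.rep * normPrimeIdeal S.O q, S.mul_normPrimeIdeal_mem_of_dvd hq c.rep_mem⟩

/-- **The Atkin–Lehner involution `W_{p⁺}` at a prime `p ∤ N⁻`** (`p^e ∥ N⁺`, `e = v_p(N⁺)`, possibly `e = 0`):
`[I] ↦ [I 𝔔_{p^e}]` on `Cls O` (Bertolini–Darmon's `W_{l⁺}`). [cite: BertoliniDarmon1996, §1.5] [cite: VignerasLNM800, Ch. II §2 (normalisateur d'un ordre d'Eichler)] -/
def XiSetup.wPlus (p : ℕ) [Fact p.Prime] (hp : ¬ p ∣ Nminus) : ClassSet S.O → ClassSet S.O := fun c =>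
  Quotient.mk (rightClassSetoid S.O)
    ⟨c.rep * atkinLehnerIdeal S.O (p ^ Nplus.factorization p), S.mul_atkinLehnerIdeal_mem hp c.rep_mem⟩

/-- `W_{q⁻} c = [I_c 𝔓_q]` (definitional). [cite: BertoliniDarmon1996, §1.5] -/
theorem XiSetup.wMinus_apply {q : ℕ} [Fact q.Prime] (hq : q ∣ Nminus) (c : ClassSet S.O) :
    S.wMinus q hq c =
      Quotient.mk (rightClassSetoid S.O) ⟨c.rep * normPrimeIdeal S.O q, S.mul_normPrimeIdeal_mem_of_dvd hq c.rep_mem⟩ :=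
  rfl

/-- `W_{p⁺} c = [I_c 𝔔_{p^{v_p(N⁺)}}]` (definitional). [cite: BertoliniDarmon1996, §1.5] -/
theorem XiSetup.wPlus_apply {p : ℕ} [Fact p.Prime] (hp : ¬ p ∣ Nminus) (c : ClassSet S.O) :
    S.wPlus p hp c =
      Quotient.mk (rightClassSetoid S.O)
        ⟨c.rep * atkinLehnerIdeal S.O (p ^ Nplus.factorization p), S.mul_atkinLehnerIdeal_mem hp c.rep_mem⟩ :=
  rfl

/-- **`W_{q⁻} [I] = [I 𝔓_q]` on any representative.** [cite: VignerasLNM800, Ch. III §5 exercice 5.8 (b)] -/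
theorem XiSetup.wMinus_mk {q : ℕ} [Fact q.Prime] (hq : q ∣ Nminus) (I : rightIdeals S.O) :
    S.wMinus q hq (Quotient.mk (rightClassSetoid S.O) I) =
      Quotient.mk (rightClassSetoid S.O) ⟨(I : Submodule ℤ S.D) * normPrimeIdeal S.O q, S.mul_normPrimeIdeal_mem_of_dvd hq I.2⟩ :=
  S.mk_rep_mk_mul (fun _ hI => S.mul_normPrimeIdeal_mem_of_dvd hq hI) I

/-- **`W_{p⁺} [I] = [I 𝔔]` on any representative.** [cite: BertoliniDarmon1996, §1.5] -/
theorem XiSetup.wPlus_mk {p : ℕ} [Fact p.Prime] (hp : ¬ p ∣ Nminus) (I : rightIdeals S.O) :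
    S.wPlus p hp (Quotient.mk (rightClassSetoid S.O) I) =
      Quotient.mk (rightClassSetoid S.O)
        ⟨(I : Submodule ℤ S.D) * atkinLehnerIdeal S.O (p ^ Nplus.factorization p), S.mul_atkinLehnerIdeal_mem hp I.2⟩ :=
  S.mk_rep_mk_mul (fun _ hI => S.mul_atkinLehnerIdeal_mem hp hI) I

/-- **`W_{q⁻}` is an involution** (`𝔓_q² = q O`). [cite: VignerasLNM800, Ch. II §1 Cor. 1.7 and Ch. III §5 exercice 5.8 (c)] -/
theorem XiSetup.wMinus_wMinus {q : ℕ} [hq' : Fact q.Prime] (hq : q ∣ Nminus) (c : ClassSet S.O) :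
    S.wMinus q hq (S.wMinus q hq c) = c :=
  S.mk_rep_mul_mk_rep_mul_eq_self (fun _ hI => S.mul_normPrimeIdeal_mem_of_dvd hq hI) hq'.out.ne_zero
    (fun _ hI => S.mul_normPrimeIdeal_mul_normPrimeIdeal_of_dvd hq hI) c

/-- **`W_{p⁺}` is an involution** (`𝔔² = p^e O`). [cite: VignerasLNM800, Ch. II §2 (normalisateur)] [cite: BertoliniDarmon1996, §1.5] -/
theorem XiSetup.wPlus_wPlus {p : ℕ} [hp' : Fact p.Prime] (hp : ¬ p ∣ Nminus) (c : ClassSet S.O) :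
    S.wPlus p hp (S.wPlus p hp c) = c :=
  S.mk_rep_mul_mk_rep_mul_eq_self (fun _ hI => S.mul_atkinLehnerIdeal_mem hp hI) (pow_ne_zero _ hp'.out.ne_zero)
    (fun _ hI => S.mul_atkinLehnerIdeal_mul_atkinLehnerIdeal hp hI) c

/-- `W_{q⁻}` is involutive, as a `Function.Involutive` statement. [cite: VignerasLNM800, Ch. III §5 exercice 5.8 (c)] -/
theorem XiSetup.involutive_wMinus {q : ℕ} [Fact q.Prime] (hq : q ∣ Nminus) : Function.Involutive (S.wMinus q hq) :=
  S.wMinus_wMinus hq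

/-- `W_{p⁺}` is involutive. [cite: BertoliniDarmon1996, §1.5] -/
theorem XiSetup.involutive_wPlus {p : ℕ} [Fact p.Prime] (hp : ¬ p ∣ Nminus) : Function.Involutive (S.wPlus p hp) :=
  S.wPlus_wPlus hp

/-- `W_{q⁻}` is a bijection of `Cls O`. [cite: VignerasLNM800, Ch. III §5 exercice 5.8 (c)] -/
theorem XiSetup.bijective_wMinus {q : ℕ} [Fact q.Prime] (hq : q ∣ Nminus) : Function.Bijective (S.wMinus q hq) :=
  (S.involutive_wMinus hq).bijective

/-- `W_{p⁺}` is a bijection of `Cls O`. [cite: BertoliniDarmon1996, §1.5] -/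
theorem XiSetup.bijective_wPlus {p : ℕ} [Fact p.Prime] (hp : ¬ p ∣ Nminus) : Function.Bijective (S.wPlus p hp) :=
  (S.involutive_wPlus hp).bijective

/-- **`W_{q⁻} W_{q'⁻} = W_{q'⁻} W_{q⁻}`** (`𝔓_q 𝔓_{q'} = 𝔓_{q'} 𝔓_q`). [cite: VignerasLNM800, Ch. III §5 exercice 5.8 (d)] -/
theorem XiSetup.wMinus_comm {q q' : ℕ} [hqf : Fact q.Prime] [hqf' : Fact q'.Prime] (hq : q ∣ Nminus) (hq' : q' ∣ Nminus)
    (c : ClassSet S.O) : S.wMinus q hq (S.wMinus q' hq' c) = S.wMinus q' hq' (S.wMinus q hq c) := by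
  by_cases hqq : q = q'
  · subst hqq; rfl
  · exact S.mk_rep_mul_comm (fun _ hI => S.mul_normPrimeIdeal_mem_of_dvd hq hI)
      (fun _ hI => S.mul_normPrimeIdeal_mem_of_dvd hq' hI)
      (normPrimeIdeal_mul_normPrimeIdeal_comm S.isZOrder_O hqf.out hqf'.out hqq) c

/-- **`W_{p⁺} W_{p'⁺} = W_{p'⁺} W_{p⁺}`** (`𝔔_m 𝔔_{m'} = 𝔔_{m'} 𝔔_m` for coprime `m, m'`). [cite: VignerasLNM800, Ch. III §5] [cite: BertoliniDarmon1996, §1.5] -/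
theorem XiSetup.wPlus_comm {p p' : ℕ} [hpf : Fact p.Prime] [hpf' : Fact p'.Prime] (hp : ¬ p ∣ Nminus) (hp' : ¬ p' ∣ Nminus)
    (c : ClassSet S.O) : S.wPlus p hp (S.wPlus p' hp' c) = S.wPlus p' hp' (S.wPlus p hp c) := by
  by_cases hpp : p = p'
  · subst hpp; rfl
  · exact S.mk_rep_mul_comm (fun _ hI => S.mul_atkinLehnerIdeal_mem hp hI) (fun _ hI => S.mul_atkinLehnerIdeal_mem hp' hI)
      (atkinLehnerIdeal_mul_atkinLehnerIdeal_comm S.isZOrder_O (pow_ne_zero _ hpf.out.ne_zero)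
        (pow_ne_zero _ hpf'.out.ne_zero)
        (Nat.Coprime.pow _ _ ((Nat.coprime_primes hpf.out hpf'.out).mpr hpp))) c

/-- **`W_{p⁺} W_{q⁻} = W_{q⁻} W_{p⁺}`** (`𝔔_{p^e} 𝔓_q = 𝔓_q 𝔔_{p^e}`, `q ≠ p`). [cite: VignerasLNM800, Ch. III §5 exercice 5.8 (d)] [cite: BertoliniDarmon1996, §1.5] -/
theorem XiSetup.wPlus_wMinus_comm {p q : ℕ} [hpf : Fact p.Prime] [hqf : Fact q.Prime] (hp : ¬ p ∣ Nminus) (hq : q ∣ Nminus)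
    (c : ClassSet S.O) : S.wPlus p hp (S.wMinus q hq c) = S.wMinus q hq (S.wPlus p hp c) :=
  S.mk_rep_mul_comm (fun _ hI => S.mul_atkinLehnerIdeal_mem hp hI) (fun _ hI => S.mul_normPrimeIdeal_mem_of_dvd hq hI)
    (atkinLehnerIdeal_mul_normPrimeIdeal_comm S.isZOrder_O (pow_ne_zero _ hpf.out.ne_zero)
      (not_dvd_pow_of_dvd hqf.out hpf.out hp hq _)) c

/-- At a prime `p ∤ N⁺ N⁻` the operator `W_{p⁺}` is the identity (`𝔔_1 = O`, `I O = I`). [cite: VignerasLNM800, Ch. III §5 exercice 5.8 (`L(A)` for principal `A`)] -/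
theorem XiSetup.wPlus_eq_self_of_not_dvd {p : ℕ} [Fact p.Prime] (hp : ¬ p ∣ Nminus) (hpN : ¬ p ∣ Nplus) (c : ClassSet S.O) :
    S.wPlus p hp c = c := by
  rw [S.wPlus_apply]
  have h0 : Nplus.factorization p = 0 := Nat.factorization_eq_zero_of_not_dvd hpN
  have hR : c.rep * S.O = c.rep := by
    have := mul_rightOrder_self c.rep
    rwa [c.rep_mem.2.1] at this
  have hT : c.rep * atkinLehnerIdeal S.O (p ^ Nplus.factorization p) = c.rep := by
    rw [h0, pow_zero, atkinLehnerIdeal_one S.isZOrder_O, hR]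
  have e : (Quotient.mk (rightClassSetoid S.O)
      ⟨c.rep * atkinLehnerIdeal S.O (p ^ Nplus.factorization p), S.mul_atkinLehnerIdeal_mem hp c.rep_mem⟩ : ClassSet S.O) =
      Quotient.mk (rightClassSetoid S.O) ⟨c.rep, c.rep_mem⟩ :=
    Quotient.sound ⟨1, show c.rep = (1 : S.Dˣ) • (c.rep * atkinLehnerIdeal S.O (p ^ Nplus.factorization p)) by
      rw [one_smul, hT]⟩
  exact e.trans (ClassSet.mk_rep c)

/-- For a setup of type `(1, p)`, `W_{p⁻}` is the involution `c ↦ [I_c P]` of `DefiniteMaximalOrdersLeftOrderFibres.lean`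
(same lattice, definitionally). [cite: VignerasLNM800, Ch. III §5 exercice 5.8 (b)–(c)] -/
theorem XiSetup.wMinus_eq {p : ℕ} [Fact p.Prime] (S₁ : XiSetup 1 p) (c : ClassSet S₁.O) :
    S₁.wMinus p (dvd_refl p) c =
      Quotient.mk (rightClassSetoid S₁.O) ⟨c.rep * normPrimeIdeal S₁.O p, S₁.rep_mul_normPrimeIdeal_mem c⟩ :=
  rfl

/-! ## §4 Types and weights are Atkin–Lehner invariant -/

/-- **`O_L(I 𝔓_q) = O_L(I)`** for every right `O`-ideal `I` and `q ∣ N⁻`. [cite: Voight2021, 18.4.8 and Lemma 17.4.11] -/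
theorem XiSetup.leftOrder_mul_normPrimeIdeal_of_dvd {q : ℕ} [hqf : Fact q.Prime] (hq : q ∣ Nminus) {I : Submodule ℤ S.D}
    (hI : I ∈ rightIdeals S.O) : leftOrder (I * normPrimeIdeal S.O q) = leftOrder I :=
  S.leftOrder_mul_eq_of_mul_mul hqf.out.ne_zero (S.mul_normPrimeIdeal_mul_normPrimeIdeal_of_dvd hq hI)

/-- **`O_L(I 𝔔_{p^e}) = O_L(I)`** for every right `O`-ideal `I` and `p ∤ N⁻` (the Atkin–Lehner ideal normalises the left
orders). [cite: VignerasLNM800, Ch. II §2 (normalisateur d'un ordre d'Eichler)] [cite: BertoliniDarmon1996, §1.5] -/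
theorem XiSetup.leftOrder_mul_atkinLehnerIdeal {p : ℕ} [hpf : Fact p.Prime] (hp : ¬ p ∣ Nminus) {I : Submodule ℤ S.D}
    (hI : I ∈ rightIdeals S.O) : leftOrder (I * atkinLehnerIdeal S.O (p ^ Nplus.factorization p)) = leftOrder I :=
  S.leftOrder_mul_eq_of_mul_mul (pow_ne_zero _ hpf.out.ne_zero) (S.mul_atkinLehnerIdeal_mul_atkinLehnerIdeal hp hI)

/-- **`W_{q⁻}` preserves the type**: `typeOf (W_{q⁻} c) = typeOf c`. [cite: Voight2021, Remark 17.4.15 and Prop. 18.5.10] -/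
theorem XiSetup.typeOf_wMinus {q : ℕ} [hqf : Fact q.Prime] (hq : q ∣ Nminus) (c : ClassSet S.O) :
    typeOf S.O (S.wMinus q hq c) = typeOf S.O c :=
  S.typeOf_mk_rep_mul (fun _ hI => S.mul_normPrimeIdeal_mem_of_dvd hq hI) hqf.out.ne_zero
    (fun _ hI => S.mul_normPrimeIdeal_mul_normPrimeIdeal_of_dvd hq hI) c

/-- **`W_{p⁺}` preserves the type**: `typeOf (W_{p⁺} c) = typeOf c`. [cite: Voight2021, Remark 17.4.15 and 23.4.14] [cite: BertoliniDarmon1996, §1.5] -/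
theorem XiSetup.typeOf_wPlus {p : ℕ} [hpf : Fact p.Prime] (hp : ¬ p ∣ Nminus) (c : ClassSet S.O) :
    typeOf S.O (S.wPlus p hp c) = typeOf S.O c :=
  S.typeOf_mk_rep_mul (fun _ hI => S.mul_atkinLehnerIdeal_mem hp hI) (pow_ne_zero _ hpf.out.ne_zero)
    (fun _ hI => S.mul_atkinLehnerIdeal_mul_atkinLehnerIdeal hp hI) c

/-- **The Brandt weights are `W_{q⁻}`-invariant**: `w_{W_{q⁻} c} = w_c`. [cite: Voight2021, 41.1.3 and 18.4.8] -/
theorem XiSetup.weight_wMinus {q : ℕ} [hqf : Fact q.Prime] (hq : q ∣ Nminus) (c : ClassSet S.O) :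
    weight S.O (S.wMinus q hq c) = weight S.O c :=
  weight_eq_weight_of_typeOf_eq (S.typeOf_wMinus hq c)

/-- **The Brandt weights are `W_{p⁺}`-invariant**: `w_{W_{p⁺} c} = w_c`. [cite: Voight2021, 41.1.3] [cite: BertoliniDarmon1996, §1.5] -/
theorem XiSetup.weight_wPlus {p : ℕ} [hpf : Fact p.Prime] (hp : ¬ p ∣ Nminus) (c : ClassSet S.O) :
    weight S.O (S.wPlus p hp c) = weight S.O c :=
  weight_eq_weight_of_typeOf_eq (S.typeOf_wPlus hp c)

/-! ## §5 `T(q)` is the permutation matrix of `W_{q⁻}` for every Brandt setup -/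

open Classical in
/-- **At every ramified prime `q ∣ N⁻` the Brandt matrix `T(q)` of a Brandt setup is the permutation matrix of `W_{q⁻}`**:
`T(q)_{c c'} = 1` if `c = W_{q⁻} c'` and `0` otherwise (the unique right ideal of index `q²` in `I_{c'}` is `I_{c'} 𝔓_q`;
transported from `BrandtData.ofOrder_T_ramified_apply`). [cite: VignerasLNM800, Ch. III §5 exercice 5.8 (b) (`c(p) = 1` for `p ∣ D`)] -/
theorem XiSetup.matrix_ramified_apply_of_dvd {q : ℕ} [Fact q.Prime] (hq : q ∣ Nminus) (c c' : ClassSet S.O) :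
    matrix S.O q c c' = if c = S.wMinus q hq c' then 1 else 0 := by
  have hO := S.isZOrder_O
  have h : rightIdeals S.O = invertibleRightIdeals S.O :=
    rightIdeals_eq_invertibleRightIdeals_of_isTotallyDefinite S.isTotallyDefinite hO
  have hIi : IsInvertibleRightIdeal S.O c'.rep := S.isInvertibleRightIdeal_of_mem c'.rep_mem
  have he : ClassSet.equivRightIdealClass h c = RightIdealClass.mk ⟨c.rep, h ▸ c.rep_mem⟩ := by
    have := ClassSet.equivRightIdealClass_mk h ⟨c.rep, c.rep_mem⟩
    rwa [ClassSet.mk_rep] at this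
  have he' : ClassSet.equivRightIdealClass h c' = RightIdealClass.mk ⟨c'.rep, h ▸ c'.rep_mem⟩ := by
    have := ClassSet.equivRightIdealClass_mk h ⟨c'.rep, c'.rep_mem⟩
    rwa [ClassSet.mk_rep] at this
  have hT := BrandtData.ofOrder_T_equivRightIdealClass hO h q c' c
  rw [← hT, he, he', BrandtData.ofOrder_T_mk hO ⟨c'.rep, h ▸ c'.rep_mem⟩]
  have key : c = S.wMinus q hq c' ↔
      RightIdealClass.mk ⟨c'.rep * normPrimeIdeal S.O q,
          isInvertibleRightIdeal_mul_normPrimeIdeal (S.hdiv_of_dvd hq) (S.maximalAt_of_dvd hq) hO hIi⟩ =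
        RightIdealClass.mk ⟨c.rep, h ▸ c.rep_mem⟩ := by
    rw [S.wMinus_apply, ← (ClassSet.equivRightIdealClass h).apply_eq_iff_eq, he, ClassSet.equivRightIdealClass_mk, eq_comm]
  by_cases hc : c = S.wMinus q hq c'
  · rw [if_pos hc]
    have := subidealCount_ramified_eq_one (S.hdiv_of_dvd hq) (S.maximalAt_of_dvd hq) hO hIi (key.mp hc)
    change ((subidealCount S.O c'.rep q _ : ℕ) : ℤ) = 1
    rw [this, Nat.cast_one]
  · rw [if_neg hc]
    have := subidealCount_ramified_eq_zero (S.hdiv_of_dvd hq) (S.maximalAt_of_dvd hq) hO hIi (fun e => hc (key.mpr e))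
    change ((subidealCount S.O c'.rep q _ : ℕ) : ℤ) = 0
    rw [this, Nat.cast_zero]

/-- `W_{q⁻} c' = c ⟺ W_{q⁻} c = c'` (an involution). [cite: VignerasLNM800, Ch. III §5 exercice 5.8 (c)] -/
theorem XiSetup.wMinus_eq_iff {q : ℕ} [Fact q.Prime] (hq : q ∣ Nminus) (c c' : ClassSet S.O) :
    S.wMinus q hq c' = c ↔ S.wMinus q hq c = c' :=
  (S.involutive_wMinus hq).eq_iff.trans eq_comm

open Classical in
/-- **The diagonal of `T(q)`**: `T(q)_{cc} = 1` iff `W_{q⁻}` fixes `c`. [cite: VignerasLNM800, Ch. III §5 exercice 5.8 (b)] -/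
theorem XiSetup.matrix_ramified_diag_of_dvd {q : ℕ} [Fact q.Prime] (hq : q ∣ Nminus) (c : ClassSet S.O) :
    matrix S.O q c c = if S.wMinus q hq c = c then 1 else 0 := by
  rw [S.matrix_ramified_apply_of_dvd hq c c]
  split_ifs with h1 h2 h2
  · rfl
  · exact absurd h1.symm h2
  · exact absurd h2.symm h1
  · rfl

/-- **`T(q)` is symmetric** (the permutation matrix of an involution). [cite: VignerasLNM800, Ch. III §5 exercice 5.8 (b)–(c)] -/
theorem XiSetup.matrix_ramified_symm_of_dvd {q : ℕ} [Fact q.Prime] (hq : q ∣ Nminus) (c c' : ClassSet S.O) :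
    matrix S.O q c c' = matrix S.O q c' c := by
  rw [S.matrix_ramified_apply_of_dvd hq c c', S.matrix_ramified_apply_of_dvd hq c' c]
  have h := S.wMinus_eq_iff hq c c'
  split_ifs with h1 h2 h2
  · rfl
  · exact absurd (h.mp h1.symm).symm h2
  · exact absurd (h.mpr h2.symm).symm h1
  · rfl

/-- **`T(q)` acts on functions on `Cls O` by `(T(q) v)(c) = v(W_{q⁻} c)`** (over `ℤ`). [cite: VignerasLNM800, Ch. III §5 exercice 5.8 (b)] -/
theorem XiSetup.matrix_ramified_mulVec_of_dvd [Fintype (ClassSet S.O)] {q : ℕ} [Fact q.Prime] (hq : q ∣ Nminus)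
    (v : ClassSet S.O → ℤ) (c : ClassSet S.O) :
    (Matrix.mulVec (matrix S.O q) v) c = v (S.wMinus q hq c) := by
  classical
  rw [Matrix.mulVec, dotProduct]
  have h : ∀ d : ClassSet S.O, matrix S.O q c d = matrix S.O q d c := fun d => S.matrix_ramified_symm_of_dvd hq c d
  simp only [h, S.matrix_ramified_apply_of_dvd hq, ite_mul, one_mul, zero_mul, Finset.sum_ite_eq', Finset.mem_univ,
    if_true]

/-- Column sums of `T(q)` are `1`: each column of the permutation matrix has a single `1`. [cite: VignerasLNM800, Ch. III §5 exercice 5.8 (b) (`c(p) = 1`)] -/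
theorem XiSetup.sum_matrix_ramified_of_dvd [Fintype (ClassSet S.O)] {q : ℕ} [Fact q.Prime] (hq : q ∣ Nminus)
    (c' : ClassSet S.O) : ∑ c, matrix S.O q c c' = 1 := by
  classical
  simp only [S.matrix_ramified_apply_of_dvd hq, Finset.sum_ite_eq', Finset.mem_univ, if_true]

end Brandt

end Literature.NumberTheory.Automorphic

end
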